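import Summits.Ventures.Crystal3D.Theorems.StickyWulffConstantCoaxialWallLawWordCellPlane
import Summits.Ventures.Crystal3D.Theorems.StickyWulffConstantCoaxialWallLawInPlaneSlotSharp
import Summits.Ventures.Crystal3D.Theorems.StickyWulffConstantCoaxialWallLawForeignTilt
import Summits.Ventures.Crystal3D.Theorems.StickyWulffConstantCoaxialWallLawInteriorLedger
import Summits.Ventures.Crystal3D.Theorems.StickyWulffConstantGenericWallFloorSampleDeficitUpper
import Summits.Ventures.Crystal3D.Theorems.StickyWulffConstantNoReconstructionGainLatticeAdhesion
import HarnessLib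

/-!
# The NET rung of `stub_coaxialTwoSlabAdhesion` for TRANSLATION pairs: arbitrary fillings, NO residual

HONEST FRAMING. Part of the venture `Summits/Ventures/Crystal3D` (cell `crystal3d-full`), helper
`--supports` the crux `CoaxialWallLaw` (stmt-Ventures-19481, `route-Ventures-StickyWulffConstant`),
REGISTERED line `WallLedgerF` (planner cf-p1 gen 16), open stub `stub_coaxialTwoSlabAdhesion`.
RUNG CREDIT ONLY — this is NOT the stub.  Brick W11c, the capstone of the v2 (NET) word automaton for
TRANSLATION pairs (memo F-NET-TRANSLATIONS, 19481-p2 g2): the two grains have the SAME linear lattice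
`A₁·Λ₀ = A₂·Λ₀` and differ by an offset; the word automaton rooted at a slot `w` never reaches the top coset
when the offset is SKEW for the slot `s ⊥ w` (`2⟪A₁⁻¹(t₂ − t₁), s⟫ ∉ ℤ`, the plane invariant of `…WordPlane`),
so every forced line ends at a payer or at the rim.

**Theorem (`translate_twoSlabAdhesion_general_net`).**  For two grains `A₁·Λ₀ + t₁`, `A₂·Λ₀ + t₂` with
`A₁·Λ₀ = A₂·Λ₀`, a slot `w` with rise `(A₁ w)₂ ≥ 0`, a slot `s ⊥ w`, and a skew offset, there are `C` and
`R₀ = 10` such that for every `h ≥ 0`, `ρ ≥ R₀`, every `1`-separated `X` in the cell with the two complete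
slab samples `P₁ ⊆ X`, `P₂ ⊆ X ∖ P₁` (the stub's cell; `KissingGap δ`, `KissingClassification δ` by name):
`cross(P₁, X∖P₁) + cross(P₂, Y) ≤ D(Y) + (φ₁ + φ₂ − √2 (A₁ w)₂ / 5720) π ρ² + C (1 + h) ρ` — NO residual, no
axis, no regime.  (No co-axiality is needed here: the statement is about any translation pair.)

**Corollary (`coaxialTwoSlabAdhesion_general_trans_net`).**  Under the crux's co-axiality data with axis
`L e₃`, `A₁·Λ₀ = A₂·Λ₀`, and an offset skew for every NON-BASAL slot (`⟪A₁ s, L e₃⟫ ≠ 0 ⇒ 2⟪A₁⁻¹(t₂−t₁), s⟫ ∉ ℤ`;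
this holds for the basal Shockley partials `±(a + b + c)/3` of the axis face, the stacking-fault offsets):
`cross ≤ D(Y) + (φ₁ + φ₂ − (√6/11440)·√(1 − ⟪L e₃, e₃⟫²)) π ρ² + C (1 + h) ρ`, via the SHARP in-plane slot
(`exists_inPlane_slot_of_coaxial_sharp`, rise `≥ (√3/2) sin θ`) — whose orthogonal slot is never basal
(`inner_inPlane_slots_ne_zero`: two in-plane slots of one `{111}` plane are never orthogonal).  Same constant as
19481-p1's in-plane twin rung `coaxialTwoSlabAdhesion_general_twin_inPlane`.

WHAT THIS IS NOT: not the stub (offsets that are lattice-plus-basal-plane vectors for every root — e.g. a pure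
`c`-axis shift — are not covered; constant `≪ ½`); F-C1 not moved.
-/

noncomputable section

namespace Summit.Ventures.Crystal3D.Theorems

open Summit.Ventures.Crystal3D Finset
open Literature.MathematicalPhysics.StatisticalMechanics (fccStacking barlowStacking IsHaggSeq
  contactDeficiency)
open scoped InnerProductSpace

/-- **Two in-plane slots of one `{111}` plane are never orthogonal.** -/
theorem inner_inPlane_slots_ne_zero (A : EuclideanSpace ℝ (Fin 3) ≃ₗᵢ[ℝ] EuclideanSpace ℝ (Fin 3))
    {n : EuclideanSpace ℝ (Fin 3)} (hn : ‖n‖ = 1)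
    (hmenu : ∀ w ∈ fccSlots, ⟪A w, n⟫_ℝ = 0 ∨ ⟪A w, n⟫_ℝ = Real.sqrt (2 / 3) ∨ ⟪A w, n⟫_ℝ = -Real.sqrt (2 / 3))
    {w s : EuclideanSpace ℝ (Fin 3)} (hw : w ∈ fccSlots) (hs : s ∈ fccSlots)
    (hw0 : ⟪A w, n⟫_ℝ = 0) (hs0 : ⟪A s, n⟫_ℝ = 0) : ⟪w, s⟫_ℝ ≠ 0 := by
  obtain ⟨u₁, hu₁, u₂, hu₂, u₃, hu₃, hn₁, hn₂, hn₃, i12, i13, i23, hind, -⟩ := exists_far_frame A hn hmenu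
  have h11 : ⟪u₁, u₁⟫_ℝ = 1 := by rw [real_inner_self_eq_norm_sq, norm_eq_one_of_mem_fccSlots hu₁, one_pow]
  have h22 : ⟪u₂, u₂⟫_ℝ = 1 := by rw [real_inner_self_eq_norm_sq, norm_eq_one_of_mem_fccSlots hu₂, one_pow]
  have h33 : ⟪u₃, u₃⟫_ℝ = 1 := by rw [real_inner_self_eq_norm_sq, norm_eq_one_of_mem_fccSlots hu₃, one_pow]
  have i21 : ⟪u₂, u₁⟫_ℝ = 1 / 2 := by rw [real_inner_comm]; exact i12
  have i31 : ⟪u₃, u₁⟫_ℝ = 1 / 2 := by rw [real_inner_comm]; exact i13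
  have i32 : ⟪u₃, u₂⟫_ℝ = 1 / 2 := by rw [real_inner_comm]; exact i23
  have hw' := inPlane_slot_eq_sub_far A hn hu₁ hu₂ hu₃ hn₁ hn₂ hn₃ i12 i13 i23 hind hw hw0
  have hs' := inPlane_slot_eq_sub_far A hn hu₁ hu₂ hu₃ hn₁ hn₂ hn₃ i12 i13 i23 hind hs hs0
  rcases hw' with rfl | rfl | rfl | rfl | rfl | rfl <;> rcases hs' with rfl | rfl | rfl | rfl | rfl | rfl <;>
    · simp only [inner_sub_left, inner_sub_right, h11, h22, h33, i12, i13, i23, i21, i31, i32]; norm_num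

/-- **An orthogonal slot.**  Every slot has a slot orthogonal to it. -/
theorem exists_orth_slot {w : EuclideanSpace ℝ (Fin 3)} (hw : w ∈ fccSlots) :
    ∃ s ∈ fccSlots, ⟪w, s⟫_ℝ = 0 := by
  obtain ⟨v, hv, v', hv', iwv, iwv', ivv'⟩ := exists_face_of_slot hw
  have hnv : ‖v‖ = 1 := norm_eq_one_of_mem_fccSlots hv
  have hnv' : ‖v'‖ = 1 := norm_eq_one_of_mem_fccSlots hv'
  refine ⟨v - v', mem_fccSlots_of_unit (fcc_sub_site_mem (mem_fcc_of_mem_fccSlots hv) (mem_fcc_of_mem_fccSlots hv')) ?_,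
    by rw [inner_sub_right, iwv, iwv', sub_self]⟩
  have h : ‖v - v'‖ ^ 2 = 1 := by rw [@norm_sub_sq_real, hnv, hnv', ivv']; norm_num
  nlinarith [norm_nonneg (v - v')]

open scoped Classical in
/-- **The NET rung for TRANSLATION pairs (general fillings, skew offset, no residual).**  See the module
docstring. -/
theorem translate_twoSlabAdhesion_general_net {δ : ℝ} (hg : KissingGap δ) (hc : KissingClassification δ)
    (A₁ : EuclideanSpace ℝ (Fin 3) ≃ₗᵢ[ℝ] EuclideanSpace ℝ (Fin 3)) (t₁ : EuclideanSpace ℝ (Fin 3))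
    (A₂ : EuclideanSpace ℝ (Fin 3) ≃ₗᵢ[ℝ] EuclideanSpace ℝ (Fin 3)) (t₂ : EuclideanSpace ℝ (Fin 3))
    (htrans : A₁ '' fccStacking 1 (Real.sqrt (2 / 3)) = A₂ '' fccStacking 1 (Real.sqrt (2 / 3)))
    {w : EuclideanSpace ℝ (Fin 3)} (hw : w ∈ fccSlots) (hα : 0 ≤ (A₁ w) 2)
    {s : EuclideanSpace ℝ (Fin 3)} (hs : s ∈ fccSlots) (hws : ⟪w, s⟫_ℝ = 0)
    (hskew : ∀ z : ℤ, ⟪A₁.symm (t₂ - t₁), s⟫_ℝ ≠ (z : ℝ) / 2) :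
    ∃ C R₀ : ℝ, 1 ≤ R₀ ∧ ∀ h : ℝ, 0 ≤ h → ∀ ρ : ℝ, R₀ ≤ ρ →
      ∀ X P₁ P₂ : Finset (EuclideanSpace ℝ (Fin 3)),
      (∀ p ∈ X, ∀ q ∈ X, p ≠ q → 1 ≤ dist p q) → P₁ ⊆ X → P₂ ⊆ X \ P₁ →
      (∀ p ∈ X, -(2 * R₀) ≤ p 2 ∧ p 2 ≤ h + 2 * R₀ ∧ p 0 ^ 2 + p 1 ^ 2 ≤ ρ ^ 2) →
      (∀ p, p ∈ P₁ ↔ (p ∈ (fun q => A₁ q + t₁) '' fccStacking 1 (Real.sqrt (2 / 3)) ∧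
        -(2 * R₀) ≤ p 2 ∧ p 2 ≤ -R₀ ∧ p 0 ^ 2 + p 1 ^ 2 ≤ ρ ^ 2)) →
      (∀ p, p ∈ P₂ ↔ (p ∈ (fun q => A₂ q + t₂) '' fccStacking 1 (Real.sqrt (2 / 3)) ∧
        h + R₀ ≤ p 2 ∧ p 2 ≤ h + 2 * R₀ ∧ p 0 ^ 2 + p 1 ^ 2 ≤ ρ ^ 2)) →
      ((((P₁ ×ˢ (X \ P₁)).filter fun pq => dist pq.1 pq.2 = 1).card : ℕ) : ℝ) +
        ((((P₂ ×ˢ ((X \ P₁) \ P₂)).filter fun pq => dist pq.1 pq.2 = 1).card : ℕ) : ℝ) ≤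
        contactDeficiency ((X \ P₁) \ P₂) +
          (Real.sqrt 2 / 4 * ∑ᶠ w ∈ {w ∈ fccStacking 1 (Real.sqrt (2 / 3)) | ‖w‖ = 1},
              |⟪w, A₁.symm (EuclideanSpace.single (2 : Fin 3) (1 : ℝ))⟫_ℝ| +
            Real.sqrt 2 / 4 * ∑ᶠ w ∈ {w ∈ fccStacking 1 (Real.sqrt (2 / 3)) | ‖w‖ = 1},
              |⟪w, A₂.symm (EuclideanSpace.single (2 : Fin 3) (1 : ℝ))⟫_ℝ| -
            Real.sqrt 2 * (A₁ w) 2 / 5720) * Real.pi * ρ ^ 2 +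
          C * (1 + h) * ρ := by
  set e₃ : EuclideanSpace ℝ (Fin 3) := EuclideanSpace.single (2 : Fin 3) (1 : ℝ) with he₃
  obtain ⟨C₁, hC₁⟩ := affineSampleDeficit_upper A₁ t₁ 10 (by norm_num)
  obtain ⟨C₂, hC₂⟩ := affineSampleDeficit_upper A₂ t₂ 10 (by norm_num)
  -- the top grain in the bottom frame
  have hΛ₂ : (fun q => A₂ q + t₂) '' fccStacking 1 (Real.sqrt (2 / 3)) =
      (fun q => A₁ q + t₂) '' fccStacking 1 (Real.sqrt (2 / 3)) := by
    have e2 : (fun q => A₂ q + t₂) '' fccStacking 1 (Real.sqrt (2 / 3)) =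
        (fun y => y + t₂) '' (A₂ '' fccStacking 1 (Real.sqrt (2 / 3))) := by rw [Set.image_image]
    have e1 : (fun q => A₁ q + t₂) '' fccStacking 1 (Real.sqrt (2 / 3)) =
        (fun y => y + t₂) '' (A₁ '' fccStacking 1 (Real.sqrt (2 / 3))) := by rw [Set.image_image]
    rw [e2, e1, htrans]
  -- the constant
  have hCE0 : (0 : ℝ) ≤ 12 * Real.sqrt 2 * Real.pi + 36 * 10 + 55440 := by positivity
  refine ⟨|C₁| + |C₂| + (240 * Real.sqrt 2 * Real.pi + 3120 * (4 * 10 + 2)) / 2 +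
    (12 * Real.sqrt 2 * Real.pi + 36 * 10 + 55440) / 5720, 10, by norm_num, ?_⟩
  intro h hh ρ hρ X P₁ P₂ hX hP₁X hP₂X₁ hcyl hP₁ hP₂
  set φ₁ : ℝ := Real.sqrt 2 / 4 * ∑ᶠ w ∈ {w ∈ fccStacking 1 (Real.sqrt (2 / 3)) | ‖w‖ = 1},
      |⟪w, A₁.symm e₃⟫_ℝ| with hφ₁
  set φ₂ : ℝ := Real.sqrt 2 / 4 * ∑ᶠ w ∈ {w ∈ fccStacking 1 (Real.sqrt (2 / 3)) | ‖w‖ = 1},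
      |⟪w, A₂.symm e₃⟫_ℝ| with hφ₂
  have hP₂X : P₂ ⊆ X := hP₂X₁.trans sdiff_subset
  have hρ0 : (0 : ℝ) ≤ ρ := by linarith
  -- (1) the two slab samples from above
  have hD₁ := hC₁ (-(2 * 10)) (-10) (by norm_num) ρ hρ P₁ hP₁
  have hD₂ := hC₂ (h + 10) (h + 2 * 10) (by ring) ρ hρ P₂ hP₂
  -- (2) the interior ledger
  have hled := ledger_ge_faces_add_interior A₁ t₁ A₂ t₂ X P₁ P₂ 10 h ρ le_rfl hh hρ hX hcyl hP₁X hP₂X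
    hP₁ hP₂
  have hf₁ : Real.sqrt 2 / 4 * ∑ w ∈ fccSlots, |⟪A₁ w, e₃⟫_ℝ| = φ₁ := by
    rw [hφ₁, finsum_unit_fcc_symm_eq_sum_slots]
  have hf₂ : Real.sqrt 2 / 4 * ∑ w ∈ fccSlots, |⟪A₂ w, e₃⟫_ℝ| = φ₂ := by
    rw [hφ₂, finsum_unit_fcc_symm_eq_sum_slots]
  rw [hf₁, hf₂, ← two_mul_contactDeficiency_eq_sum X] at hled
  have hPAY : ((X.filter fun z => (X.filter fun q => dist z q = 1).card ≤ 11 ∧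
        -10 - 2 ≤ z 2 ∧ z 2 ≤ h + 10 + 2).card : ℝ) ≤
      ((X.filter fun y => (X.filter fun q => dist y q = 1).card ≠ 12 ∧
        -10 - 2 ≤ y 2 ∧ y 2 ≤ h + 10 + 2).card : ℝ) := by
    exact_mod_cast card_le_card fun z hz => by
      rw [mem_filter] at hz ⊢
      exact ⟨hz.1, by have := hz.2.1; omega, hz.2.2⟩
  -- (3) the payers of the interior window, fed by the NET flux (no band) — or nothing if the root is flat
  have hP₂' : ∀ p, p ∈ P₂ ↔ (p ∈ (fun q => A₁ q + t₂) '' fccStacking 1 (Real.sqrt (2 / 3)) ∧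
      h + 10 ≤ p 2 ∧ p 2 ≤ h + 2 * 10 ∧ p 0 ^ 2 + p 1 ^ 2 ≤ ρ ^ 2) := by
    intro p; rw [hP₂, hΛ₂]
  have hpay : Real.sqrt 2 * (A₁ w) 2 * Real.pi * ρ ^ 2 - (12 * Real.sqrt 2 * Real.pi + 36 * 10 + 55440) * ρ ≤
      2860 * ((X.filter fun z => (X.filter fun q => dist z q = 1).card ≤ 11 ∧
          -10 - 2 ≤ z 2 ∧ z 2 ≤ h + 10 + 2).card : ℝ) := by
    rcases lt_or_eq_of_le hα with hαpos | hα0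
    · exact wordNet_trans_payers_ge_plane hg hc A₁ hw hαpos hs hws t₁ t₂ hskew X P₁ P₂ 10 h ρ le_rfl hh hρ hX
        hcyl hP₁X hP₂X hP₁ hP₂'
    · rw [← hα0]
      have h0 : 0 ≤ (12 * Real.sqrt 2 * Real.pi + 36 * 10 + 55440) * ρ := mul_nonneg hCE0 hρ0
      have h1 : (0 : ℝ) ≤ 2860 * ((X.filter fun z => (X.filter fun q => dist z q = 1).card ≤ 11 ∧
          -10 - 2 ≤ z 2 ∧ z 2 ≤ h + 10 + 2).card : ℝ) := by positivity
      nlinarith only [h0, h1]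
  -- (4) the two splits of the skeleton
  have hs₁ := contactDeficiency_sdiff_split hP₁X
  have hs₂ := contactDeficiency_sdiff_split hP₂X₁
  -- (5) assemble
  have ha : C₁ * ρ ≤ |C₁| * (1 + h) * ρ := by
    have h1 : C₁ * ρ ≤ |C₁| * ρ := mul_le_mul_of_nonneg_right (le_abs_self _) hρ0
    have h2 : 0 ≤ |C₁| * h * ρ := by positivity
    linarith only [h1, h2]
  have hb : C₂ * ρ ≤ |C₂| * (1 + h) * ρ := by
    have h1 : C₂ * ρ ≤ |C₂| * ρ := mul_le_mul_of_nonneg_right (le_abs_self _) hρ0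
    have h2 : 0 ≤ |C₂| * h * ρ := by positivity
    linarith only [h1, h2]
  have hCE : (12 * Real.sqrt 2 * Real.pi + 36 * 10 + 55440) * ρ ≤
      (12 * Real.sqrt 2 * Real.pi + 36 * 10 + 55440) * (1 + h) * ρ := by
    have := mul_nonneg (mul_nonneg hCE0 hh) hρ0
    linarith only [this]
  set PAY' : Finset (EuclideanSpace ℝ (Fin 3)) := X.filter fun y => (X.filter fun q => dist y q = 1).card ≠ 12 ∧
    -10 - 2 ≤ y 2 ∧ y 2 ≤ h + 10 + 2
  have t1 : ((((P₁ ×ˢ (X \ P₁)).filter fun pq => dist pq.1 pq.2 = 1).card : ℕ) : ℝ) +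
      ((((P₂ ×ˢ ((X \ P₁) \ P₂)).filter fun pq => dist pq.1 pq.2 = 1).card : ℕ) : ℝ) =
      contactDeficiency P₁ + contactDeficiency P₂ + contactDeficiency ((X \ P₁) \ P₂) -
        contactDeficiency X := by linarith only [hs₁, hs₂]
  have t2 : Real.sqrt 2 * (A₁ w) 2 * Real.pi * ρ ^ 2 - (12 * Real.sqrt 2 * Real.pi + 36 * 10 + 55440) * ρ ≤
      2860 * (PAY'.card : ℝ) := by
    linarith only [hpay, hPAY]
  have t3 : 2 * φ₁ * Real.pi * ρ ^ 2 + 2 * φ₂ * Real.pi * ρ ^ 2 + (PAY'.card : ℝ) -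
      (240 * Real.sqrt 2 * Real.pi + 3120 * (4 * 10 + 2)) * (1 + h) * ρ ≤ 2 * contactDeficiency X := by
    linarith only [hled]
  have t4 : contactDeficiency P₁ ≤ 2 * φ₁ * Real.pi * ρ ^ 2 + C₁ * ρ := hD₁
  have t5 : contactDeficiency P₂ ≤ 2 * φ₂ * Real.pi * ρ ^ 2 + C₂ * ρ := hD₂
  linarith only [t1, t2, t3, t4, t5, ha, hb, hCE]

open scoped Classical in
/-- **The NET rung of `stub_coaxialTwoSlabAdhesion` for co-axial TRANSLATION pairs with an offset skew to all
non-basal slots (stacking-fault offsets), charge `(√6/11440)·sin θ`, no residual.**  See the module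
docstring. -/
theorem coaxialTwoSlabAdhesion_general_trans_net {δ : ℝ} (hg : KissingGap δ) (hc : KissingClassification δ)
    (A₁ : EuclideanSpace ℝ (Fin 3) ≃ₗᵢ[ℝ] EuclideanSpace ℝ (Fin 3)) (t₁ : EuclideanSpace ℝ (Fin 3))
    (A₂ : EuclideanSpace ℝ (Fin 3) ≃ₗᵢ[ℝ] EuclideanSpace ℝ (Fin 3)) (t₂ : EuclideanSpace ℝ (Fin 3))
    (L : EuclideanSpace ℝ (Fin 3) ≃ₗᵢ[ℝ] EuclideanSpace ℝ (Fin 3)) (s₁ : EuclideanSpace ℝ (Fin 3))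
    (σ : ℤ → ℤ) (hσ : IsHaggSeq σ)
    (hsub₁ : (fun p => A₁ p + t₁) '' fccStacking 1 (Real.sqrt (2 / 3)) ⊆
      (fun p => L p + s₁) '' barlowStacking 1 (Real.sqrt (2 / 3)) σ)
    (htrans : A₁ '' fccStacking 1 (Real.sqrt (2 / 3)) = A₂ '' fccStacking 1 (Real.sqrt (2 / 3)))
    (hskew : ∀ s ∈ fccSlots, ⟪A₁ s, L (EuclideanSpace.single (2 : Fin 3) (1 : ℝ))⟫_ℝ ≠ 0 →
      ∀ z : ℤ, ⟪A₁.symm (t₂ - t₁), s⟫_ℝ ≠ (z : ℝ) / 2) :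
    ∃ C R₀ : ℝ, 1 ≤ R₀ ∧ ∀ h : ℝ, 0 ≤ h → ∀ ρ : ℝ, R₀ ≤ ρ →
      ∀ X P₁ P₂ : Finset (EuclideanSpace ℝ (Fin 3)),
      (∀ p ∈ X, ∀ q ∈ X, p ≠ q → 1 ≤ dist p q) → P₁ ⊆ X → P₂ ⊆ X \ P₁ →
      (∀ p ∈ X, -(2 * R₀) ≤ p 2 ∧ p 2 ≤ h + 2 * R₀ ∧ p 0 ^ 2 + p 1 ^ 2 ≤ ρ ^ 2) →
      (∀ p, p ∈ P₁ ↔ (p ∈ (fun q => A₁ q + t₁) '' fccStacking 1 (Real.sqrt (2 / 3)) ∧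
        -(2 * R₀) ≤ p 2 ∧ p 2 ≤ -R₀ ∧ p 0 ^ 2 + p 1 ^ 2 ≤ ρ ^ 2)) →
      (∀ p, p ∈ P₂ ↔ (p ∈ (fun q => A₂ q + t₂) '' fccStacking 1 (Real.sqrt (2 / 3)) ∧
        h + R₀ ≤ p 2 ∧ p 2 ≤ h + 2 * R₀ ∧ p 0 ^ 2 + p 1 ^ 2 ≤ ρ ^ 2)) →
      ((((P₁ ×ˢ (X \ P₁)).filter fun pq => dist pq.1 pq.2 = 1).card : ℕ) : ℝ) +
        ((((P₂ ×ˢ ((X \ P₁) \ P₂)).filter fun pq => dist pq.1 pq.2 = 1).card : ℕ) : ℝ) ≤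
        contactDeficiency ((X \ P₁) \ P₂) +
          (Real.sqrt 2 / 4 * ∑ᶠ w ∈ {w ∈ fccStacking 1 (Real.sqrt (2 / 3)) | ‖w‖ = 1},
              |⟪w, A₁.symm (EuclideanSpace.single (2 : Fin 3) (1 : ℝ))⟫_ℝ| +
            Real.sqrt 2 / 4 * ∑ᶠ w ∈ {w ∈ fccStacking 1 (Real.sqrt (2 / 3)) | ‖w‖ = 1},
              |⟪w, A₂.symm (EuclideanSpace.single (2 : Fin 3) (1 : ℝ))⟫_ℝ| -
            (Real.sqrt 6 / 11440 : ℝ) * Real.sqrt (1 - ⟪L (EuclideanSpace.single (2 : Fin 3) (1 : ℝ)),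
              (EuclideanSpace.single (2 : Fin 3) (1 : ℝ))⟫_ℝ ^ 2)) * Real.pi * ρ ^ 2 +
          C * (1 + h) * ρ := by
  set e₃ : EuclideanSpace ℝ (Fin 3) := EuclideanSpace.single (2 : Fin 3) (1 : ℝ) with he₃
  have he₃1 : ‖e₃‖ = 1 := by rw [he₃, PiLp.norm_single, norm_one]
  have hn1 : ‖L e₃‖ = 1 := by rw [LinearIsometryEquiv.norm_map, he₃1]
  -- the sharp in-plane slot `w` and its orthogonal slot `s`
  obtain ⟨w, hw, hw0, hwup, hsharp⟩ := exists_inPlane_slot_of_coaxial_sharp A₁ t₁ L s₁ hσ hsub₁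
  obtain ⟨s, hs, hws⟩ := exists_orth_slot hw
  have hmenu := menu_axis_of_coaxial A₁ t₁ L s₁ σ hsub₁
  have hsn : ⟪A₁ s, L e₃⟫_ℝ ≠ 0 := fun hs0 => inner_inPlane_slots_ne_zero A₁ hn1 hmenu hw hs hw0 hs0 hws
  have hα : 0 ≤ (A₁ w) 2 := by rw [apply_two_eq_inner_e₃]; exact hwup
  obtain ⟨C, R₀, hR₀, hmain⟩ := translate_twoSlabAdhesion_general_net hg hc A₁ t₁ A₂ t₂ htrans hw hα hs hws
    (hskew s hs hsn)
  refine ⟨C, R₀, hR₀, ?_⟩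
  intro h hh ρ hρ X P₁ P₂ hX hP₁X hP₂X₁ hcyl hP₁ hP₂
  have key := hmain h hh ρ hρ X P₁ P₂ hX hP₁X hP₂X₁ hcyl hP₁ hP₂
  -- the sharp slot beats `(√6/2) sin θ`
  have hw2 : (A₁ w) 2 = ⟪A₁ w, e₃⟫_ℝ := apply_two_eq_inner_e₃ _
  have hflux : Real.sqrt 6 / 11440 * Real.sqrt (1 - ⟪L e₃, e₃⟫_ℝ ^ 2) ≤ Real.sqrt 2 * (A₁ w) 2 / 5720 := by
    rw [abs_of_nonneg hwup] at hsharp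
    rw [hw2]
    linarith only [hsharp]
  have hπρ : 0 ≤ Real.pi * ρ ^ 2 := by positivity
  have := mul_le_mul_of_nonneg_right hflux hπρ
  linarith only [key, this]

end Summit.Ventures.Crystal3D.Theorems

end
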